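import Summits.AnomalousDissipation.AnomalousDissipation.Theses.MirrorVariety

/-!
# Negative knowledge for the crux `TaylorGreenLoudGalerkinStates` (stmt-AnomalousDissipation-2987, route MirrorVariety):
# load-bearing analysis — energy identity, force, constants window, resolution floor

Certified copy of §0–§3 of the cdisprove work file `Cruxes/TaylorGreenLoudGalerkinStates/Disproof.lean`
(refuter-cdisprove-stmt-AnomalousDissipation-2987-0, cycle 1). Supports stmt-AnomalousDissipation-2987; no positive
route-item statement is asserted.

* `crux_iff` — the crux ↔ `LoudBoundedStates tgForce` (the `∀ f, f = f_TG →` binder is sugar).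
* `energy_identity` — every admissible Galerkin steady state has `ν‖∇U‖² = ∫⟪f, U⟫` (Temam 1979 Ch. II (1.29)).
* `taylorGreenLoud_false_without_force` — the force-free weakening `TaylorGreenLoudGalerkinStatesWithoutForce` is FALSE
  (`f = 0`: loudness = injection = 0). Any proof must use `f_TG ≠ 0` quantitatively.
* `loudness_le_sqrt_energy`, `not_loud_of_energy_lt_sq` — for `f_TG`, `ν‖∇U‖² ≤ √(∫|U|²)`; the strengthening with
  `E < ε²` is FALSE (sharp window `ε ≤ √E/2`).
* `gradNormSq_le_of_isBandLimited` (Bernstein `‖∇U‖² ≤ 4π²N²∫|U|²`), `resolution_floor` (`ε ≤ 4π²νN²E`),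
  `not_loud_at_fixed_resolution`, `not_loud_uniformly_in_resolution` — for EVERY force the fixed-resolution strengthening
  and the quantifier swap `∀ᶠ N, ∀ j` are FALSE: witnesses live on the diagonal `N_j ≳ (ε/Eν_j)^{1/2}`.
* `not_loud_with_one_state` — the witness must depend on `j`.
* `not_crux_iff` — `¬ crux` unfolded: a uniform-in-`N` laminarisation theorem for bounded steady Galerkin TG states along
  every `ν_j → 0⁺` (what a refutation must prove; open in 3-D).
-/

noncomputable section

open scoped InnerProductSpace Topology
open MeasureTheory Filter
open Literature.Analysis.FunctionSpaces Literature.Analysis.FunctionSpaces.Torus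

namespace Summit.AnomalousDissipation.AnomalousDissipation.Theorems.TaylorGreenLoudGalerkinStates.Negative

/-! ## §0 Vocabulary (transparent restatements of the crux's own clauses) -/

/-- The Taylor–Green force of the crux, verbatim:
`f_TG = (sin2πx₀ cos2πx₁ cos2πx₂, −cos2πx₀ sin2πx₁ cos2πx₂, 0)` (`(fourier 1 t).im = sin 2πt`, `.re = cos 2πt`). -/
def tgForce : UnitAddTorus (Fin 3) → EuclideanSpace ℝ (Fin 3) := fun x =>
  !₂[(fourier 1 (x 0) : ℂ).im * (fourier 1 (x 1) : ℂ).re * (fourier 1 (x 2) : ℂ).re,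
    -((fourier 1 (x 0) : ℂ).re * (fourier 1 (x 1) : ℂ).im * (fourier 1 (x 2) : ℂ).re), (0 : ℝ)]

/-- Band-limitation to the punctured frequency ball `0 < |k|² ≤ N²` (verbatim the crux's clause). -/
def IsBandLimited (N : ℕ) (U : UnitAddTorus (Fin 3) → EuclideanSpace ℝ (Fin 3)) : Prop :=
  ∀ k ∉ (freqBall N).erase (0 : Fin 3 → ℤ),
    UnitAddTorus.mFourierCoeff (EuclideanSpace.complexify ∘ U) k = 0

/-- Admissible Galerkin steady state at `(ν, N)` for the force `f` — verbatim the bracket of the crux: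
smooth, div-free, mean-zero, band-limited, and the tested Galerkin equations against every band-limited
smooth div-free test. -/
def IsSteadyState (ν : ℝ) (N : ℕ) (f U : UnitAddTorus (Fin 3) → EuclideanSpace ℝ (Fin 3)) : Prop :=
  IsSmooth U ∧ IsDivFree U ∧ HasZeroMean U ∧ IsBandLimited N U ∧
    ∀ a : UnitAddTorus (Fin 3) → EuclideanSpace ℝ (Fin 3), IsSmooth a → IsDivFree a → IsBandLimited N a →
      ∫ x, (⟪U x, convect U a x⟫_ℝ + ν * ⟪U x, laplacian a x⟫_ℝ + ⟪f x, a x⟫_ℝ) = 0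

/-- The crux's matrix: along `ν`, with constants `E`, `ε`, for every `j` and all large `N` a loud bounded state. -/
def LoudAlong (f : UnitAddTorus (Fin 3) → EuclideanSpace ℝ (Fin 3)) (ν : ℕ → ℝ) (E ε : ℝ) : Prop :=
  ∀ j, ∀ᶠ N in atTop, ∃ U : UnitAddTorus (Fin 3) → EuclideanSpace ℝ (Fin 3),
    IsSteadyState (ν j) N f U ∧ ∫ x, ‖U x‖ ^ 2 ≤ E ∧ ε ≤ ν j * gradNormSq U

/-- The crux's conclusion for a general force `f`. -/
def LoudBoundedStates (f : UnitAddTorus (Fin 3) → EuclideanSpace ℝ (Fin 3)) : Prop :=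
  ∃ (ν : ℕ → ℝ) (E ε : ℝ), (∀ j, 0 < ν j) ∧ Tendsto ν atTop (𝓝 0) ∧ 0 < ε ∧ LoudAlong f ν E ε

/-- The `∀ f, f = f_TG → …` binder of the crux is sugar: crux ↔ its instance at `tgForce`. [folklore] -/
theorem crux_iff :
    Summit.AnomalousDissipation.AnomalousDissipation.Theses.MirrorVariety.TaylorGreenLoudGalerkinStates ↔
      LoudBoundedStates tgForce := by
  constructor
  · intro h
    exact h tgForce rfl
  · rintro h f rfl
    exact h

/-! ## §1 The exact energy (injection) identity of an admissible state -/

/-- The zero field is divergence free. [folklore] -/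
theorem isDivFree_zero : IsDivFree (fun _ : UnitAddTorus (Fin 3) => (0 : EuclideanSpace ℝ (Fin 3))) := by
  intro x
  simp [divergence, partialDeriv, Torus.lineDeriv]

/-- **Energy identity.** Every admissible Galerkin steady state at `(ν, N)` for a continuous force `f` satisfies
`ν ‖∇U‖² = ∫ ⟪f, U⟫` — test the equations with `a := U` (allowed: `U` is smooth, div-free, band-limited), use
the antisymmetry `∫⟪U,(U·∇)U⟫ = 0` and Green `∫⟪U, ΔU⟫ = −‖∇U‖²` (Temam 1979 Ch. II (1.29)). [folklore] -/
theorem energy_identity {ν : ℝ} {N : ℕ} {f U : UnitAddTorus (Fin 3) → EuclideanSpace ℝ (Fin 3)}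
    (hU : IsSteadyState ν N f U) (hf : Continuous f) :
    ν * gradNormSq U = ∫ x, ⟪f x, U x⟫_ℝ := by
  obtain ⟨hs, hdiv, -, hband, htest⟩ := hU
  have h := htest U hs hdiv hband
  have h1 : ∫ x, ⟪U x, convect U U x⟫_ℝ = 0 := by
    have ha := integral_inner_convect_eq_neg hs hdiv hs hs
    have hc : ∫ x, ⟪convect U U x, U x⟫_ℝ = ∫ x, ⟪U x, convect U U x⟫_ℝ :=
      integral_congr_ae (ae_of_all _ fun x => real_inner_comm _ _)
    linarith
  have h2 : ∫ x, ⟪U x, laplacian U x⟫_ℝ = -gradNormSq U := by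
    have hint : ∀ i, Integrable (fun x => ‖partialDeriv i U x‖ ^ 2) volume := fun i =>
      ((hs.partialDeriv i).continuous.norm.pow 2).integrable_unitAddTorus
    rw [integral_inner_laplacian_eq_neg_holds hs, gradNormSq, integral_finsetSum _ fun i _ => hint i]
  have i1 : Integrable (fun x => ⟪U x, convect U U x⟫_ℝ) volume := (hs.inner (hs.convect hs)).integrable
  have i2 : Integrable (fun x => ν * ⟪U x, laplacian U x⟫_ℝ) volume :=
    (hs.inner hs.laplacian).integrable.const_mul ν
  have i3 : Integrable (fun x => ⟪f x, U x⟫_ℝ) volume :=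
    (hf.inner hs.continuous).integrable_unitAddTorus
  have i12 : Integrable (fun x => ⟪U x, convect U U x⟫_ℝ + ν * ⟪U x, laplacian U x⟫_ℝ) volume := i1.add i2
  rw [integral_add i12 i3, integral_add i1 i2, integral_const_mul, h1, h2] at h
  linarith

/-! ## §2 Load-bearing analysis

### (a) The force hypothesis is load-bearing -/

/-- The crux with its only hypothesis (`f = f_TG`) dropped, i.e. weakened to "every smooth div-free mean-zero
force has loud bounded Galerkin steady states". -/
def TaylorGreenLoudGalerkinStatesWithoutForce : Prop :=
  ∀ f : UnitAddTorus (Fin 3) → EuclideanSpace ℝ (Fin 3), IsSmooth f → IsDivFree f → HasZeroMean f →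
    LoudBoundedStates f

/-- No loud Galerkin steady states for the zero force: loudness equals injection, which vanishes. [folklore] -/
theorem not_loudBoundedStates_zero :
    ¬ LoudBoundedStates (fun _ : UnitAddTorus (Fin 3) => (0 : EuclideanSpace ℝ (Fin 3))) := by
  rintro ⟨ν, E, ε, -, -, hε, h⟩
  obtain ⟨N, U, hU, -, hloud⟩ := (h 0).exists
  have hid := energy_identity hU continuous_const
  simp only [inner_zero_left, integral_zero] at hid
  linarith

/-- **Any proof must use the force.** The force-free weakening of the crux is false (witness `f = 0`). [folklore] -/
theorem taylorGreenLoud_false_without_force : ¬ TaylorGreenLoudGalerkinStatesWithoutForce := fun h =>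
  not_loudBoundedStates_zero (h _ (isSmooth_const _) isDivFree_zero (by simp [HasZeroMean]))

/-! ### (b) The constants: loudness never exceeds the injection ceiling `√E` -/

/-- Pointwise bound `‖f_TG(x)‖ ≤ 1` (`sin²a cos²b + cos²a sin²b ≤ (sin²a + cos²a)(cos²b + sin²b) = 1`, `cos² ≤ 1`). [folklore] -/
theorem norm_tgForce_le (x : UnitAddTorus (Fin 3)) : ‖tgForce x‖ ≤ 1 := by
  have hn : ∀ i : Fin 3, ((fourier 1 (x i) : ℂ)).re ^ 2 + ((fourier 1 (x i) : ℂ)).im ^ 2 = 1 := by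
    intro i
    have h1 : ‖(fourier 1 (x i) : ℂ)‖ = 1 := by
      rw [fourier_apply]
      exact Circle.norm_coe _
    have h2 := Complex.sq_norm (fourier 1 (x i) : ℂ)
    rw [h1, Complex.normSq_apply] at h2
    nlinarith [h2]
  have hsq : ‖tgForce x‖ ^ 2 =
      (((fourier 1 (x 0) : ℂ)).im * ((fourier 1 (x 1) : ℂ)).re * ((fourier 1 (x 2) : ℂ)).re) ^ 2 +
        (((fourier 1 (x 0) : ℂ)).re * ((fourier 1 (x 1) : ℂ)).im * ((fourier 1 (x 2) : ℂ)).re) ^ 2 := by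
    rw [EuclideanSpace.real_norm_sq_eq, Fin.sum_univ_three]
    simp only [tgForce, PiLp.toLp_apply, Matrix.cons_val_zero, Matrix.cons_val_one, Matrix.cons_val_two,
      Matrix.head_cons, Matrix.tail_cons]
    ring
  have hle : (((fourier 1 (x 0) : ℂ)).im * ((fourier 1 (x 1) : ℂ)).re * ((fourier 1 (x 2) : ℂ)).re) ^ 2 +
      (((fourier 1 (x 0) : ℂ)).re * ((fourier 1 (x 1) : ℂ)).im * ((fourier 1 (x 2) : ℂ)).re) ^ 2 ≤ 1 := by
    have h0 := hn 0
    have h1 := hn 1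
    have h2 := hn 2
    generalize ((fourier 1 (x 0) : ℂ)).re = r0 at h0 ⊢
    generalize ((fourier 1 (x 0) : ℂ)).im = s0 at h0 ⊢
    generalize ((fourier 1 (x 1) : ℂ)).re = r1 at h1 ⊢
    generalize ((fourier 1 (x 1) : ℂ)).im = s1 at h1 ⊢
    generalize ((fourier 1 (x 2) : ℂ)).re = r2 at h2 ⊢
    generalize ((fourier 1 (x 2) : ℂ)).im = s2 at h2 ⊢
    have hA : s0 ^ 2 * r1 ^ 2 + r0 ^ 2 * s1 ^ 2 ≤ 1 := by
      have hprod : (r0 ^ 2 + s0 ^ 2) * (r1 ^ 2 + s1 ^ 2) = 1 := by rw [h0, h1, one_mul]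
      nlinarith [sq_nonneg (s0 * s1), sq_nonneg (r0 * r1)]
    have hB : r2 ^ 2 ≤ 1 := by nlinarith [sq_nonneg s2]
    have hA0 : 0 ≤ s0 ^ 2 * r1 ^ 2 + r0 ^ 2 * s1 ^ 2 := by positivity
    calc (s0 * r1 * r2) ^ 2 + (r0 * s1 * r2) ^ 2 = r2 ^ 2 * (s0 ^ 2 * r1 ^ 2 + r0 ^ 2 * s1 ^ 2) := by ring
      _ ≤ 1 * 1 := mul_le_mul hB hA hA0 zero_le_one
      _ = 1 := one_mul 1
  rw [← hsq] at hle
  exact (sq_le_one_iff₀ (norm_nonneg _)).1 hle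

/-- `f_TG` is continuous. [folklore] -/
theorem continuous_tgForce : Continuous tgForce := by
  have hc : ∀ i : Fin 3, Continuous fun x : UnitAddTorus (Fin 3) => (fourier 1 (x i) : ℂ) := fun i =>
    (fourier 1).continuous.comp (continuous_apply i)
  unfold tgForce
  refine (PiLp.continuous_toLp 2 _).comp ?_
  refine continuous_pi fun i => ?_
  fin_cases i
  · exact ((Complex.continuous_im.comp (hc 0)).mul (Complex.continuous_re.comp (hc 1))).mul
      (Complex.continuous_re.comp (hc 2))
  · exact (((Complex.continuous_re.comp (hc 0)).mul (Complex.continuous_im.comp (hc 1))).mul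
      (Complex.continuous_re.comp (hc 2))).neg
  · exact continuous_const

/-- `∫ ‖U‖ ≤ √(∫ ‖U‖²)` on the (probability) torus, for continuous `U` (Jensen / AM–GM with a free parameter). [folklore] -/
theorem integral_norm_le_sqrt {U : UnitAddTorus (Fin 3) → EuclideanSpace ℝ (Fin 3)} (hU : Continuous U) :
    ∫ x, ‖U x‖ ≤ Real.sqrt (∫ x, ‖U x‖ ^ 2) := by
  set I := ∫ x, ‖U x‖ ^ 2 with hI
  have hI0 : 0 ≤ I := integral_nonneg fun _ => sq_nonneg _
  have i1 : Integrable (fun x => ‖U x‖) volume := hU.norm.integrable_unitAddTorus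
  have i2 : Integrable (fun x => ‖U x‖ ^ 2) volume := (hU.norm.pow 2).integrable_unitAddTorus
  -- AM–GM with parameter `t > 0`: `‖U x‖ ≤ t/2 + ‖U x‖²/(2t)`
  have hAMGM : ∀ t : ℝ, 0 < t → ∫ x, ‖U x‖ ≤ t / 2 + I / (2 * t) := by
    intro t ht
    have hpt : ∀ x, ‖U x‖ ≤ t / 2 + ‖U x‖ ^ 2 / (2 * t) := by
      intro x
      have h2t : 0 < 2 * t := by positivity
      rw [div_add_div _ _ two_ne_zero h2t.ne', le_div_iff₀ (by positivity)]
      nlinarith [sq_nonneg (‖U x‖ - t)]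
    calc ∫ x, ‖U x‖ ≤ ∫ x, (t / 2 + ‖U x‖ ^ 2 / (2 * t)) :=
          integral_mono i1 ((integrable_const _).add (i2.div_const _)) hpt
      _ = t / 2 + I / (2 * t) := by
          rw [integral_add (integrable_const _) (i2.div_const _), integral_const, integral_div]
          simp [hI]
  rcases hI0.lt_or_eq with hpos | hzero
  · have ht : 0 < Real.sqrt I := Real.sqrt_pos.2 hpos
    have h := hAMGM (Real.sqrt I) ht
    have hsq : I = Real.sqrt I * Real.sqrt I := (Real.mul_self_sqrt hI0).symm
    calc ∫ x, ‖U x‖ ≤ Real.sqrt I / 2 + I / (2 * Real.sqrt I) := h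
      _ = Real.sqrt I := by
          field_simp
          nlinarith [hsq]
  · -- `I = 0`: the bound `t/2` for every `t > 0`
    rw [← hzero, Real.sqrt_zero]
    refine le_of_forall_pos_le_add fun t ht => ?_
    have h := hAMGM t ht
    rw [← hzero, zero_div, add_zero] at h
    linarith

/-- **Injection ceiling.** For the Taylor–Green force, every admissible state has `ν‖∇U‖² = ∫⟪f_TG, U⟫ ≤ √(∫|U|²)`
(pointwise `‖f_TG‖ ≤ 1` and Jensen; the sharp constant is `‖f_TG‖_{L²} = 1/2`). [folklore] -/
theorem loudness_le_sqrt_energy {ν : ℝ} {N : ℕ} {U : UnitAddTorus (Fin 3) → EuclideanSpace ℝ (Fin 3)}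
    (hU : IsSteadyState ν N tgForce U) : ν * gradNormSq U ≤ Real.sqrt (∫ x, ‖U x‖ ^ 2) := by
  have hs : IsSmooth U := hU.1
  rw [energy_identity hU continuous_tgForce]
  calc ∫ x, ⟪tgForce x, U x⟫_ℝ ≤ ∫ x, ‖U x‖ := by
        refine integral_mono (continuous_tgForce.inner hs.continuous).integrable_unitAddTorus
          hs.continuous.norm.integrable_unitAddTorus fun x => ?_
        calc ⟪tgForce x, U x⟫_ℝ ≤ ‖tgForce x‖ * ‖U x‖ := real_inner_le_norm _ _
          _ ≤ 1 * ‖U x‖ := mul_le_mul_of_nonneg_right (norm_tgForce_le x) (norm_nonneg _)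
          _ = ‖U x‖ := one_mul _
    _ ≤ Real.sqrt (∫ x, ‖U x‖ ^ 2) := integral_norm_le_sqrt hs.continuous

/-- **Constants window (natural strengthening refuted).** The crux with the extra clause `E < ε²` is FALSE for the
Taylor–Green force: `ε ≤ ν_j‖∇U‖² ≤ √(∫|U|²) ≤ √E < ε`. So any witness has `ε² ≤ E` (indeed `4ε² ≤ E`). [folklore] -/
theorem not_loud_of_energy_lt_sq :
    ¬ ∃ (ν : ℕ → ℝ) (E ε : ℝ), (∀ j, 0 < ν j) ∧ Tendsto ν atTop (𝓝 0) ∧ 0 < ε ∧ E < ε ^ 2 ∧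
        LoudAlong tgForce ν E ε := by
  rintro ⟨ν, E, ε, -, -, hε, hE, h⟩
  obtain ⟨N, U, hU, hUE, hloud⟩ := (h 0).exists
  have h1 := loudness_le_sqrt_energy hU
  have h2 : Real.sqrt (∫ x, ‖U x‖ ^ 2) ≤ Real.sqrt E := Real.sqrt_le_sqrt hUE
  have h3 : Real.sqrt E < ε := (Real.sqrt_lt' hε).2 hE
  linarith

/-! ### (c) The resolution: bounded states are quiet at fixed `N` (Bernstein) -/

/-- **Bernstein inequality for Galerkin fields.** A smooth field band-limited to `|k|² ≤ N²` has
`‖∇U‖² ≤ 4π² N² ∫|U|²` (Parseval: `‖∇U‖² = 4π² Σ_{|k|≤N} |k|²‖Û_k‖² ≤ 4π²N² Σ ‖Û_k‖²`). [folklore] -/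
theorem gradNormSq_le_of_isBandLimited {U : UnitAddTorus (Fin 3) → EuclideanSpace ℝ (Fin 3)} (hU : IsSmooth U)
    {N : ℕ} (hband : IsBandLimited N U) :
    gradNormSq U ≤ 4 * Real.pi ^ 2 * (N : ℝ) ^ 2 * ∫ x, ‖U x‖ ^ 2 := by
  have hband' : ∀ k : Fin 3 → ℤ, (N : ℝ) ^ 2 < freqNormSq k →
      UnitAddTorus.mFourierCoeff (EuclideanSpace.complexify ∘ U) k = 0 := fun k hk =>
    hband k fun hmem => (not_mem_freqBall.2 hk) (Finset.mem_of_mem_erase hmem)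
  have hnn : 0 ≤ 4 * Real.pi ^ 2 * ∑ k ∈ freqBall N,
      freqNormSq k * ‖UnitAddTorus.mFourierCoeff (EuclideanSpace.complexify ∘ U) k‖ ^ 2 :=
    mul_nonneg (by positivity) (Finset.sum_nonneg fun k _ =>
      mul_nonneg (Finset.sum_nonneg fun i _ => sq_nonneg _) (sq_nonneg _))
  rw [gradNormSq_eq_toReal_eGradNormSq_holds hU, eGradNormSq_eq_sum_of_band_limited hU.continuous hband',
    integral_norm_sq_eq_sum_of_band_limited hU.continuous hband',
    ENNReal.toReal_ofReal hnn, Finset.mul_sum, Finset.mul_sum]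
  refine Finset.sum_le_sum fun k hk => ?_
  have hk' : freqNormSq k ≤ (N : ℝ) ^ 2 := mem_freqBall.1 hk
  have h0 : 0 ≤ ‖UnitAddTorus.mFourierCoeff (EuclideanSpace.complexify ∘ U) k‖ ^ 2 := sq_nonneg _
  calc 4 * Real.pi ^ 2 * (freqNormSq k * ‖UnitAddTorus.mFourierCoeff (EuclideanSpace.complexify ∘ U) k‖ ^ 2)
      ≤ 4 * Real.pi ^ 2 * ((N : ℝ) ^ 2 * ‖UnitAddTorus.mFourierCoeff (EuclideanSpace.complexify ∘ U) k‖ ^ 2) := by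
        gcongr
    _ = 4 * Real.pi ^ 2 * (N : ℝ) ^ 2 * ‖UnitAddTorus.mFourierCoeff (EuclideanSpace.complexify ∘ U) k‖ ^ 2 := by
        ring

/-- **Resolution floor.** A loud bounded admissible state at `(ν, N)` (any force) forces `ε ≤ 4π² ν N² E`, i.e.
`N ≥ (ε / 4π²νE)^{1/2}`: loudness at bounded energy is an `N → ∞` phenomenon along `ν_j → 0`. [folklore] -/
theorem resolution_floor {ν E ε : ℝ} {N : ℕ} {f U : UnitAddTorus (Fin 3) → EuclideanSpace ℝ (Fin 3)}
    (hν : 0 ≤ ν) (hU : IsSteadyState ν N f U) (hE : ∫ x, ‖U x‖ ^ 2 ≤ E) (hloud : ε ≤ ν * gradNormSq U) :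
    ε ≤ 4 * Real.pi ^ 2 * ν * (N : ℝ) ^ 2 * E := by
  have hB := gradNormSq_le_of_isBandLimited hU.1 hU.2.2.2.1
  calc ε ≤ ν * gradNormSq U := hloud
    _ ≤ ν * (4 * Real.pi ^ 2 * (N : ℝ) ^ 2 * ∫ x, ‖U x‖ ^ 2) := mul_le_mul_of_nonneg_left hB hν
    _ ≤ ν * (4 * Real.pi ^ 2 * (N : ℝ) ^ 2 * E) := by gcongr
    _ = 4 * Real.pi ^ 2 * ν * (N : ℝ) ^ 2 * E := by ring

/-- **Natural strengthening refuted: one resolution for all `j`.** For EVERY force `f`: there is no fixed resolution `N`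
carrying loud bounded admissible states along a sequence `ν_j → 0⁺` (`ε ≤ 4π²ν_jN²E → 0`). [folklore] -/
theorem not_loud_at_fixed_resolution (f : UnitAddTorus (Fin 3) → EuclideanSpace ℝ (Fin 3)) :
    ¬ ∃ (ν : ℕ → ℝ) (E ε : ℝ) (N : ℕ), (∀ j, 0 < ν j) ∧ Tendsto ν atTop (𝓝 0) ∧ 0 < ε ∧
        ∀ j, ∃ U : UnitAddTorus (Fin 3) → EuclideanSpace ℝ (Fin 3),
          IsSteadyState (ν j) N f U ∧ ∫ x, ‖U x‖ ^ 2 ≤ E ∧ ε ≤ ν j * gradNormSq U := by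
  rintro ⟨ν, E, ε, N, hν, hlim, hε, h⟩
  have hbound : ∀ j, ε ≤ 4 * Real.pi ^ 2 * ν j * (N : ℝ) ^ 2 * E := fun j => by
    obtain ⟨U, hU, hE, hloud⟩ := h j
    exact resolution_floor (hν j).le hU hE hloud
  have hT : Tendsto (fun j => 4 * Real.pi ^ 2 * ν j * (N : ℝ) ^ 2 * E) atTop (𝓝 (4 * Real.pi ^ 2 * 0 * (N : ℝ) ^ 2 * E)) :=
    ((tendsto_const_nhds.mul hlim).mul tendsto_const_nhds).mul tendsto_const_nhds
  rw [mul_zero, zero_mul, zero_mul] at hT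
  have : ε ≤ 0 := ge_of_tendsto' hT hbound
  linarith

/-- **Natural strengthening refuted: the quantifier swap.** For EVERY force `f`, the crux's `∀ j, ∀ᶠ N` cannot be
strengthened to `∀ᶠ N, ∀ j` (a `j`-uniform resolution threshold): false by the resolution floor. [folklore] -/
theorem not_loud_uniformly_in_resolution (f : UnitAddTorus (Fin 3) → EuclideanSpace ℝ (Fin 3)) :
    ¬ ∃ (ν : ℕ → ℝ) (E ε : ℝ), (∀ j, 0 < ν j) ∧ Tendsto ν atTop (𝓝 0) ∧ 0 < ε ∧
        ∀ᶠ N in atTop, ∀ j, ∃ U : UnitAddTorus (Fin 3) → EuclideanSpace ℝ (Fin 3),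
          IsSteadyState (ν j) N f U ∧ ∫ x, ‖U x‖ ^ 2 ≤ E ∧ ε ≤ ν j * gradNormSq U := by
  rintro ⟨ν, E, ε, hν, hlim, hε, h⟩
  obtain ⟨N, hN⟩ := h.exists
  exact not_loud_at_fixed_resolution f ⟨ν, E, ε, N, hν, hlim, hε, hN⟩

/-! ### (d) The witness must depend on `j` -/

/-- A single field cannot be loud along `ν_j → 0` (`ν_j‖∇U‖² → 0`). Trivial; recorded for completeness. [folklore] -/
theorem not_loud_with_one_state :
    ¬ ∃ (ν : ℕ → ℝ) (ε : ℝ) (U : UnitAddTorus (Fin 3) → EuclideanSpace ℝ (Fin 3)),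
        Tendsto ν atTop (𝓝 0) ∧ 0 < ε ∧ ∀ j, ε ≤ ν j * gradNormSq U := by
  rintro ⟨ν, ε, U, hlim, hε, h⟩
  have hT : Tendsto (fun j => ν j * gradNormSq U) atTop (𝓝 (0 * gradNormSq U)) := hlim.mul tendsto_const_nhds
  rw [zero_mul] at hT
  have : ε ≤ 0 := ge_of_tendsto' hT h
  linarith

/-! ## §3 What a refutation must prove -/

/-- **The negation of the crux, unfolded (pure logic).** `¬ crux` says: along EVERY positive sequence `ν_j → 0` and
for all `E`, `ε > 0`, some `j` has, for INFINITELY MANY resolutions `N`, only quiet (`ν_j‖∇U‖² < ε`) admissible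
states of energy `≤ E` — a uniform-in-`N` laminarisation theorem for bounded steady Galerkin Taylor–Green states
(route CoherentStates' `SteadyNeg` at the Galerkin level, for this force). Nothing of the kind is known in 3-D.
[folklore] -/
theorem not_crux_iff :
    ¬ Summit.AnomalousDissipation.AnomalousDissipation.Theses.MirrorVariety.TaylorGreenLoudGalerkinStates ↔
      ∀ (ν : ℕ → ℝ) (E ε : ℝ), (∀ j, 0 < ν j) → Tendsto ν atTop (𝓝 0) → 0 < ε →
        ∃ j, ∃ᶠ N in atTop, ∀ U : UnitAddTorus (Fin 3) → EuclideanSpace ℝ (Fin 3),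
          IsSteadyState (ν j) N tgForce U → ∫ x, ‖U x‖ ^ 2 ≤ E → ν j * gradNormSq U < ε := by
  rw [crux_iff]
  constructor
  · intro h ν E ε hν hlim hε
    by_contra hc
    refine h ⟨ν, E, ε, hν, hlim, hε, fun j => ?_⟩
    have hj : ¬ ∃ᶠ N in atTop, ∀ U : UnitAddTorus (Fin 3) → EuclideanSpace ℝ (Fin 3),
        IsSteadyState (ν j) N tgForce U → ∫ x, ‖U x‖ ^ 2 ≤ E → ν j * gradNormSq U < ε := fun hf => hc ⟨j, hf⟩
    rw [Filter.not_frequently] at hj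
    refine hj.mono fun N hN => ?_
    by_contra hU
    refine hN fun U hS hE => ?_
    by_contra hlt
    exact hU ⟨U, hS, hE, not_lt.1 hlt⟩
  · rintro h ⟨ν, E, ε, hν, hlim, hε, hL⟩
    obtain ⟨j, hj⟩ := h ν E ε hν hlim hε
    obtain ⟨N, ⟨U, hS, hE, hloud⟩, hN⟩ := ((hL j).and_frequently hj).exists
    exact absurd (hN U hS hE) (not_lt.2 hloud)

end Summit.AnomalousDissipation.AnomalousDissipation.Theorems.TaylorGreenLoudGalerkinStates.Negative

end
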